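import Summits.ResolutionOfSingularities.ResolutionOfSingularities.Theorems.RisoStrataDefs
import Summits.ResolutionOfSingularities.ResolutionOfSingularities.Theorems.RisoStrataRisoGlobalisationChartRing
import Summits.ResolutionOfSingularities.ResolutionOfSingularities.Theorems.RisoStrataRisoGlobalisationChartMem
import Literature.AlgebraicGeometry.Resolution.LocalBlowup

/-!
# Route RisoStrata — crux `RisoGlobalisation` (stmt-ResolutionOfSingularities-18547): local rings at centres

Line SketchIdeator1, glue part 2 of 3.  The route's `loc O B` is the tree's `locAtCentre B O`
(`coe_risoLoc_eq_locAtCentre`), and for a projective model with homogeneous coordinates `w`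
the local ring at the centre of a valuation `v`, read in `K`, is the localisation at the centre
of `v` of any chart ring `k[w_α/w_γ]` it contains (leaves `stub_chartMem`, `stub_chartRing`);
hence regularity of `loc 𝒪_v k[w_α/w_γ]` gives `RegCentre v`.
-/

-- single-problem summit: the doubled namespace component `ResolutionOfSingularities` is forced
set_option linter.dupNamespace false

namespace Summit.ResolutionOfSingularities.ResolutionOfSingularities.Theorems

open AlgebraicGeometry CategoryTheory
open Literature.AlgebraicGeometry.Resolution Literature.AlgebraicGeometry.Motives

attribute [local instance] MvPolynomial.gradedAlgebra

/-! ## Glue (models): local rings at centres, read in `K` -/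

section ModelsGlue

variable {k K : Type} [Field k] [Field K] [Algebra k K]

/-- Elements of `Algebra.adjoin k S` lie in every subring of `K` containing `k` and `S`. -/
theorem risoGlob_adjoin_le_subring {S : Set K} {T : Subring K}
    (hkT : ∀ c : k, algebraMap k K c ∈ T) (hS : S ⊆ T) {z : K} (hz : z ∈ Algebra.adjoin k S) :
    z ∈ T := by
  induction hz using Algebra.adjoin_induction with
  | mem x hx => exact hS hx
  | algebraMap c => exact hkT c
  | add x y _ _ hx hy => exact add_mem hx hy
  | mul x y _ _ hx hy => exact mul_mem hx hy

/-- For `s ≠ 0` in a valuation ring `O`: `s⁻¹ ∈ O` iff `O.valuation s = 1`. -/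
theorem risoGlob_inv_mem_valuationSubring_iff (O : ValuationSubring K) {s : K} (hs : s ∈ O)
    (hs0 : s ≠ 0) : s⁻¹ ∈ O ↔ O.valuation s = 1 := by
  rw [← O.valuation_le_one_iff, map_inv₀]
  have hv0 : O.valuation s ≠ 0 := by rwa [Ne, map_eq_zero]
  have hle : O.valuation s ≤ 1 := (O.valuation_le_one_iff s).mpr hs
  rw [inv_le_one₀ (zero_lt_iff.mpr hv0)]
  exact ⟨fun h => le_antisymm hle h, fun h => h.ge⟩

/-- **`loc O B` is `B_{𝔪_O ∩ B}`**: for `B ⊆ O` the route's `loc O B` and the tree's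
`locAtCentre B O` (LocalBlowup.lean) have the same elements. -/
theorem coe_risoLoc_eq_locAtCentre (O : ValuationSubring K) (B : Subalgebra k K)
    (hBO : ∀ z ∈ B, z ∈ O) :
    ((risoLoc O B : Subalgebra k K) : Set K) = (locAtCentre B.toSubring O : Set K) := by
  apply le_antisymm
  · intro z hz
    change z ∈ locAtCentre B.toSubring O
    refine risoGlob_adjoin_le_subring (fun c => le_locAtCentre _ O (B.algebraMap_mem c)) ?_ hz
    rintro _ ⟨a, ha, s, hs, hsO, rfl⟩
    by_cases hs0 : s = 0
    · rw [hs0, inv_zero, mul_zero]; exact Subring.zero_mem _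
    · exact mem_locAtCentre_iff.mpr ⟨a, ha, s, hs,
        (risoGlob_inv_mem_valuationSubring_iff O (hBO s hs) hs0).mp hsO, by rw [div_eq_mul_inv]⟩
  · rintro z ⟨a, ha, s, hs, hv, rfl⟩
    have hs0 : (s : K) ≠ 0 := ne_zero_of_valuation_eq_one hv
    change a / s ∈ risoLoc O B
    rw [div_eq_mul_inv]
    exact Algebra.subset_adjoin ⟨a, ha, s, hs,
      (risoGlob_inv_mem_valuationSubring_iff O (hBO s hs) hs0).mpr hv, rfl⟩

/-- Regularity of `loc O B` is regularity of `locAtCentre B O`. -/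
theorem isRegularLocalRing_locAtCentre_of_risoLoc (O : ValuationSubring K) (B : Subalgebra k K)
    (hBO : ∀ z ∈ B, z ∈ O) (hreg : IsRegularLocalRing ↥(risoLoc O B)) :
    IsRegularLocalRing ↥(locAtCentre B.toSubring O) := by
  have hset := coe_risoLoc_eq_locAtCentre O B hBO
  let e : ↥(risoLoc O B) ≃+* ↥(locAtCentre B.toSubring O) :=
    { toFun := fun z => ⟨z.1, by rw [← SetLike.mem_coe, ← hset]; exact z.2⟩
      invFun := fun z => ⟨z.1, by rw [← SetLike.mem_coe, hset]; exact z.2⟩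
      left_inv := fun z => rfl
      right_inv := fun z => rfl
      map_mul' := fun _ _ => rfl
      map_add' := fun _ _ => rfl }
  exact IsRegularLocalRing.of_ringEquiv e

variable (B : ProjModel k K) {n : ℕ} (ιB : B.X ⟶ Proj (Segre.grading (Fin (n + 1)) k))
  [IsClosedImmersion ιB] (hιB : ιB ≫ Segre.toSpec (Fin (n + 1)) k = B.π)
  (w : Fin (n + 1) → K) (hw : w ≠ 0)
  (hgenB : B.gen ≫ ιB = (ProjectiveSpace.pointOfVec k w hw).left)

include hιB hgenB in
/-- **The local ring at the centre of a valuation, in coordinates.** If all ratios `w_α/w_γ` lie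
in `𝒪_{B,y}`, `y` the centre of `v`, then `𝒪_{B,y} ⊆ K` IS the localisation at the centre of
`v` of the chart ring `k[w_α/w_γ]` (leaves `stub_chartMem`, `stub_chartRing`, and domination of
`𝒪_{B,y}` by `𝒪_v`). -/
theorem risoGlob_stalkSubring_centre_eq_locAtCentre (v : ZariskiRiemannSpace k K) (γ : Fin (n + 1))
    (hγ : w γ ≠ 0) (hmem : ∀ α, w α * (w γ)⁻¹ ∈ B.stalkSubring (B.centre v)) :
    B.stalkSubring (B.centre v) =
      locAtCentre (Algebra.adjoin k (Set.range fun α => w α * (w γ)⁻¹)).toSubring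
        v.asValuationSubring := by
  set y := B.centre v with hy
  have hdom : SubringDominates (B.stalkSubring y) v.asValuationSubring.toSubring :=
    B.isCentreOf_centre v
  have hyU : y ∈ GeneratingSections.preU ιB γ := stub_chartMem B ιB hιB w hw hgenB γ hγ y hmem
  have hC : ∀ z ∈ Algebra.adjoin k (Set.range fun α => w α * (w γ)⁻¹), z ∈ B.stalkSubring y :=
    fun z hz => risoGlob_adjoin_le_subring (fun c => B.algebraMap_mem_stalkSubring y c)
      (by rintro _ ⟨α, rfl⟩; exact hmem α) hz
  apply le_antisymm
  · intro z hz
    obtain ⟨a, ha, s, hs, hsinv, rfl⟩ := stub_chartRing B ιB hιB w hw hgenB γ y hyU z hz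
    by_cases hs0 : s = 0
    · rw [hs0, inv_zero, mul_zero]; exact Subring.zero_mem _
    · refine mem_locAtCentre_iff.mpr ⟨a, ha, s, hs, ?_, by rw [div_eq_mul_inv]⟩
      exact (risoGlob_inv_mem_valuationSubring_iff _ (hdom.1 (hC s hs)) hs0).mp (hdom.1 hsinv)
  · rintro z ⟨a, ha, s, hs, hv1, rfl⟩
    have hs0 : (s : K) ≠ 0 := ne_zero_of_valuation_eq_one hv1
    have hsinvO : s⁻¹ ∈ v.asValuationSubring :=
      (risoGlob_inv_mem_valuationSubring_iff _ (hdom.1 (hC s hs)) hs0).mpr hv1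
    rw [div_eq_mul_inv]
    exact mul_mem (hC a ha) (hdom.2 s (hC s hs) hsinvO)

include hιB hgenB in
/-- **Regular centre from a regular chart local ring** (exit of the line towards
`ProjModel.isRegular_of_forall_regCentre`): with `𝒪_{B,centre v} = (k[w_α/w_γ])_{𝔪_v ∩ ·}` as
above, regularity of the route's `loc 𝒪_v k[w_α/w_γ]` gives `B.RegCentre v`. -/
theorem risoGlob_regCentre_of_isRegularLocalRing_risoLoc (v : ZariskiRiemannSpace k K) (γ : Fin (n + 1))
    (hγ : w γ ≠ 0) (hmem : ∀ α, w α * (w γ)⁻¹ ∈ B.stalkSubring (B.centre v))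
    (hreg : IsRegularLocalRing
      ↥(risoLoc v.asValuationSubring (Algebra.adjoin k (Set.range fun α => w α * (w γ)⁻¹)))) :
    B.RegCentre v := by
  have hCO : ∀ z ∈ Algebra.adjoin k (Set.range fun α => w α * (w γ)⁻¹),
      z ∈ v.asValuationSubring :=
    fun z hz => (B.isCentreOf_centre v).1 (risoGlob_adjoin_le_subring
      (fun c => B.algebraMap_mem_stalkSubring _ c) (by rintro _ ⟨α, rfl⟩; exact hmem α) hz)
  have h1 := isRegularLocalRing_locAtCentre_of_risoLoc _ _ hCO hreg
  have heq := risoGlob_stalkSubring_centre_eq_locAtCentre B ιB hιB w hw hgenB v γ hγ hmem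
  let e : B.X.presheaf.stalk (B.centre v) ≃+*
      ↥(locAtCentre (Algebra.adjoin k (Set.range fun α => w α * (w γ)⁻¹)).toSubring
        v.asValuationSubring) :=
    (B.stalkEquiv (B.centre v)).trans (RingEquiv.subringCongr heq)
  exact IsRegularLocalRing.of_ringEquiv e.symm

end ModelsGlue

end Summit.ResolutionOfSingularities.ResolutionOfSingularities.Theorems
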